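import Summits.QuantumAdvantage.QuantumAdvantage.Theorems.NearExactIsExact.Negative.NoCaseAMM59
import Summits.QuantumAdvantage.QuantumAdvantage.Theorems.NearExactIsExact.Negative.SkewProductCore

/-!
# `NearExactIsExact` (stmt-QuantumAdvantage-14043) — THEOREM MM59 localised to four clean fibres

B2b disprover cell (gen 27), one of the files proving THEOREM MM59-W (capacity of type-O
Maiorana–McFarland functions over a quadratic map `φ : 𝔽₂⁹ → 𝔽₂⁵` is `≤ 59/64`; assembled in
`Negative.TypeOMM59WindowFourteen`). HONEST FRAMING: a kernel-checked structural lemma about quadratic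
fibrations of `𝔽₂⁹`, NOT summit progress.

THEOREM MM59 (`Negative.NoCaseAMM59`) shows that the signed fibre sums `f_a(b) = Σ_{φ(y)=a} ε_y(-1)^{b·y}`
of a quadratic `φ = (q₀,…,q₄)` with odd weights `ε` are never ALL `≡ ±3 (mod 8)`; its proof only ever uses the
hypothesis on the four fibres above the coordinate flat `{(u,v,0,0,0)}`. Here the same argument is run for the
four fibres above an ARBITRARY affine `2`-flat `{a₁ ⊕ us ⊕ vt}` (`s, t ≠ 0`, `s ≠ t`) of `𝔽₂⁵`:
* `odd_total_at` … `cen_mem_fib_at`: steps S1–S4 of MM59 with the per-fibre hypothesis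
  "fibre `a` is CLEAN" = `∀ b, f_a(b) ≡ ±3 (mod 8)` (verbatim localisations of the tree proofs);
* `glue_even_local`, `no_clean_quad`: MM59's gluing S5 and four-point lemma S6 for four clean fibres above
  four points `P(u,v)` cut out by `≤ 3` quadratic equations (an affine `2`-flat is put in this form by
  `Negative.FlatEqsFive.flat_eqs`; the combination is `Negative.TypeOMM59WindowFourteen.no_clean_flat`).
Sources: [this work]; MM59 and its folklore tools as cited there. Standard axioms only.
-/

set_option linter.dupNamespace false -- D-0017: single-problem summit ⇒ `QuantumAdvantage.QuantumAdvantage` by design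

namespace Summit.QuantumAdvantage.QuantumAdvantage.Theorems.NearExactIsExact.Negative.MM59Local

open Finset
open Literature.Computability.QuantumComplexity
open Summit.QuantumAdvantage.QuantumAdvantage.Theorems.NearExactIsExact.Negative.CentroidMoments
open Summit.QuantumAdvantage.QuantumAdvantage.Theorems.NearExactIsExact.Negative.SkewProductCore
  (ind ind_true ind_false supp prod_ind_eq decide_ind_eq_one isDegLeFun_prod)
open Summit.QuantumAdvantage.QuantumAdvantage.Theorems.NearExactIsExact.Negative.MM59

/-! ### S1–S4 of MM59 for a single clean fibre -/

section Fibration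

variable {q : Fin 5 → (Fin 9 → Bool) → Bool} {ε : (Fin 9 → Bool) → ℤ}

/-- The fibre totals `f_a(0)` are odd. [folklore] -/
theorem odd_total_at {a : Fin 5 → Bool} (hA : ∀ b, fs q ε a b % 8 = 3 ∨ fs q ε a b % 8 = 5) :
    Odd (∑ y ∈ fib q a, ε y) := by
  rw [← fs_zero, Int.odd_iff]
  have := hA (fun _ => false)
  omega

/-- `#A_a` is odd. [folklore] -/
theorem natCast_card_fib_at (hε : ∀ y, Odd (ε y)) {a : Fin 5 → Bool}
    (hA : ∀ b, fs q ε a b % 8 = 3 ∨ fs q ε a b % 8 = 5) :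
    ((#(fib q a) : ℕ) : ZMod 2) = 1 := by
  rw [← intCast_sum_odd (fib q a) ε hε, (odd_total_at hA).intCast_zmod_two]

/-- **(S2) All residues are explained by the centroid**: `f_a(b) ≡ 3 σ_a (-1)^{b·c(A_a)} (mod 8)`. [folklore] -/
theorem fs_sub_dvd_eight_at (hε : ∀ y, Odd (ε y)) {a : Fin 5 → Bool}
    (hA : ∀ b, fs q ε a b % 8 = 3 ∨ fs q ε a b % 8 = 5) (b : Fin 9 → Bool) : (8 : ℤ) ∣ fs q ε a b - 3 * sgn q ε a * zt b (cen (fib q a)) := by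
  have h0 := hA (fun _ => false)
  have hb := hA b
  have h4 : (4 : ℤ) ∣ fs q ε a b - fs q ε a (fun _ => false) * zt b (cen (fib q a)) := by
    rw [fs_zero]
    exact charSum_sub_dvd_four (fib q a) ε hε (odd_total_at hA) b
  unfold sgn
  rcases zt_eq_one_or b (cen (fib q a)) with hz | hz <;> rw [hz] at h4 ⊢ <;> split_ifs with h3 <;> omega

/-- **(S3) Second moments**: `#{y ∈ A_a : y_j = y_k = 1} ≡ c_j c_k (mod 2)` for `j ≠ k`, where
`c = c(A_a)`; from the four residues at `b ∈ {0, e_j, e_k, e_j ⊕ e_k}`. [folklore] -/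
theorem second_moment_at (hε : ∀ y, Odd (ε y)) {a : Fin 5 → Bool}
    (hA : ∀ b, fs q ε a b % 8 = 3 ∨ fs q ε a b % 8 = 5) (j k : Fin 9) :
    ((#{y ∈ fib q a | y j = true ∧ y k = true} : ℕ) : ZMod 2) =
      if (cen (fib q a) j = true ∧ cen (fib q a) k = true) then 1 else 0 := by
  set N : ℤ := ∑ y ∈ fib q a with (y j = true ∧ y k = true), ε y with hN
  have hcast : ((#{y ∈ fib q a | y j = true ∧ y k = true} : ℕ) : ZMod 2) = ((N : ℤ) : ZMod 2) := by
    rw [hN, intCast_sum_odd _ ε hε]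
  have hid : 4 * N = fs q ε a (fun _ => false) - fs q ε a (unitVec j) - fs q ε a (unitVec k)
      + fs q ε a (fun i => xor (unitVec j i) (unitVec k i)) := by
    rw [hN, Finset.sum_filter]
    unfold fs
    rw [Finset.mul_sum, ← Finset.sum_sub_distrib, ← Finset.sum_sub_distrib, ← Finset.sum_add_distrib]
    refine Finset.sum_congr rfl fun y _ => ?_
    rw [zt_xor, zt_zero, zt_unitVec, zt_unitVec,
      show ε y * 1 - ε y * (if y j = true then (-1 : ℤ) else 1) - ε y * (if y k = true then (-1 : ℤ) else 1) +
          ε y * ((if y j = true then (-1 : ℤ) else 1) * (if y k = true then (-1 : ℤ) else 1)) =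
        ε y * ((1 - (if y j = true then (-1 : ℤ) else 1)) * (1 - (if y k = true then (-1 : ℤ) else 1))) by ring,
      ind_mul_ind]
    split_ifs <;> ring
  have e0 := fs_sub_dvd_eight_at hε hA (fun _ => false)
  have ej := fs_sub_dvd_eight_at hε hA (unitVec j)
  have ek := fs_sub_dvd_eight_at hε hA (unitVec k)
  have ejk := fs_sub_dvd_eight_at hε hA (fun i => xor (unitVec j i) (unitVec k i))
  rw [zt_zero] at e0
  rw [zt_unitVec] at ej ek
  rw [zt_xor, zt_unitVec, zt_unitVec] at ejk
  have h2 : (2 : ℤ) ∣ (if (cen (fib q a) j = true ∧ cen (fib q a) k = true) then 1 else 0) - N := by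
    rcases sgn_eq_one_or (q := q) (ε := ε) a with hs | hs <;> rw [hs] at e0 ej ek ejk <;>
      cases hcj : cen (fib q a) j <;> cases hck : cen (fib q a) k <;>
        simp only [hcj, hck, Bool.false_eq_true, and_false, and_self, and_true,
          ↓reduceIte] at ej ek ejk ⊢ <;> omega
  rw [hcast, (ZMod.intCast_eq_intCast_iff_dvd_sub _ _ 2).mpr (by exact_mod_cast h2)]
  push_cast
  rfl

/-- **The fibres satisfy the moment condition** with respect to their own centroids. [folklore] -/
theorem momCond_fib_at (hε : ∀ y, Odd (ε y)) {a : Fin 5 → Bool}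
    (hA : ∀ b, fs q ε a b % 8 = 3 ∨ fs q ε a b % 8 = 5) (S : Finset (Fin 9)) (hS : #S ≤ 2) :
    ((#{y ∈ fib q a | ∀ i ∈ S, y i} : ℕ) : ZMod 2) = if (∀ i ∈ S, cen (fib q a) i) then 1 else 0 := by
  obtain h0 | h1 | h2 : #S = 0 ∨ #S = 1 ∨ #S = 2 := by omega
  · rw [Finset.card_eq_zero] at h0
    subst h0
    simp only [Finset.notMem_empty, IsEmpty.forall_iff, implies_true, ↓reduceIte]
    rw [Finset.filter_true_of_mem (fun _ _ => trivial)]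
    exact natCast_card_fib_at hε hA
  · obtain ⟨j, rfl⟩ := Finset.card_eq_one.mp h1
    simp only [Finset.mem_singleton, forall_eq]
    unfold cen coordCount
    by_cases ho : Odd #{y ∈ fib q a | y j = true}
    · rw [if_pos (by simpa using ho)]
      exact (ZMod.natCast_eq_one_iff_odd).mpr ho
    · rw [if_neg (by simpa using ho)]
      exact (ZMod.natCast_eq_zero_iff_even).mpr (Nat.not_odd_iff_even.mp ho)
  · obtain ⟨j, k, -, rfl⟩ := Finset.card_eq_two.mp h2
    simp only [Finset.mem_insert, Finset.mem_singleton, forall_eq_or_imp, forall_eq]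
    exact second_moment_at hε hA j k

/-- **(S4) The centroid lies in its fibre**: `φ(c(A_a)) = a` (apply the counting lemma to `r = qᵢ`,
which is constant on `A_a` of odd size). [folklore] -/
theorem cen_mem_fib_at (hq : ∀ i, IsDegLeFun 2 (q i)) (hε : ∀ y, Odd (ε y)) {a : Fin 5 → Bool}
    (hA : ∀ b, fs q ε a b % 8 = 3 ∨ fs q ε a b % 8 = 5) : cen (fib q a) ∈ fib q a := by
  rw [mem_fib]
  intro i
  have h := natCast_card_filter_quadratic (momCond_fib_at hε hA) (hq i)
  cases hai : a i
  · rw [Finset.filter_false_of_mem (fun y hy => by rw [(mem_fib.mp hy) i, hai]; decide),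
      Finset.card_empty, Nat.cast_zero] at h
    cases hqc : q i (cen (fib q a))
    · rfl
    · rw [hqc] at h
      exact absurd h (by decide)
  · rw [Finset.filter_true_of_mem (fun y hy => by rw [(mem_fib.mp hy) i, hai]),
      natCast_card_fib_at hε hA] at h
    cases hqc : q i (cen (fib q a))
    · rw [hqc] at h
      exact absurd h (by decide)
    · rfl
/-- Distinct clean fibres have distinct centroids. [folklore] -/
theorem cen_injective_at (hq : ∀ i, IsDegLeFun 2 (q i)) (hε : ∀ y, Odd (ε y)) {a a' : Fin 5 → Bool}
    (hA : ∀ b, fs q ε a b % 8 = 3 ∨ fs q ε a b % 8 = 5) (hA' : ∀ b, fs q ε a' b % 8 = 3 ∨ fs q ε a' b % 8 = 5)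
    (h : cen (fib q a) = cen (fib q a')) : a = a' := by
  funext i
  rw [← (mem_fib.mp (cen_mem_fib_at hq hε hA)) i, ← (mem_fib.mp (cen_mem_fib_at hq hε hA')) i, h]

/-! ### S5–S6 over four fibres cut out by at most three quadratic equations -/

/-- **Gluing (local form).** Four points `P(u,v) ∈ 𝔽₂⁵` with clean fibres, cut out by `≤ 3` equations
`c_k(y) = 0` (`k ∈ K`) each of degree `≤ 2` in `y`: for every quadratic `r` the glued function
`Π_{k∈K}[c_k(y)=0] · r(y)` has degree `≤ 8 < 9`, hence even weight `Σ_{uv} #{y ∈ A_{P(uv)} : r(y)}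
≡ Σ_{uv} r(c(A_{P(uv)})) (mod 2)`. [this work] -/
theorem glue_even_local (hε : ∀ y, Odd (ε y))
    (P : Bool × Bool → (Fin 5 → Bool)) (hP : Function.Injective P)
    (hA : ∀ uv b, fs q ε (P uv) b % 8 = 3 ∨ fs q ε (P uv) b % 8 = 5)
    (K : Finset (Fin 5)) (hK : #K ≤ 3) (c : Fin 5 → (Fin 9 → Bool) → Bool) (hc : ∀ k, IsDegLeFun 2 (c k))
    (hcP : ∀ y, (∀ k ∈ K, c k y = false) ↔ ∃ uv, y ∈ fib q (P uv))
    {r : (Fin 9 → Bool) → Bool} (hr : IsDegLeFun 2 r) :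
    (∑ uv : Bool × Bool, if r (cen (fib q (P uv))) then (1 : ZMod 2) else 0) = 0 := by
  set G : (Fin 9 → Bool) → Bool := fun y => decide ((∏ k ∈ K, ind (!c k y)) = 1) && r y with hG
  have hGdeg : IsDegLeFun 8 G :=
    (isDegLeFun_and (isDegLeFun_prod (fun k y => !c k y) K (fun k _ => isDegLeFun_not (hc k))) hr).mono
      (by omega)
  have hGeven := natCast_card_eq_zero_of_isDegLeFun hGdeg (by norm_num)
  have hGiff : ∀ y, G y = true ↔ (∀ k ∈ K, c k y = false) ∧ r y = true := by
    intro y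
    rw [hG]
    simp only [Bool.and_eq_true, decide_eq_true_eq, prod_ind_eq]
    have e : K ⊆ supp (fun k => !c k y) ↔ ∀ k ∈ K, c k y = false := by
      simp [supp, subset_iff]
    rw [← e]
    by_cases h : K ⊆ supp (fun k => !c k y)
    · rw [if_pos h]
      exact ⟨fun h' => ⟨h, h'.2⟩, fun h' => ⟨rfl, h'.2⟩⟩
    · rw [if_neg h]
      exact ⟨fun h' => absurd h'.1 zero_ne_one, fun h' => absurd h'.1 h⟩
  have hpart : #{y : Fin 9 → Bool | G y} = ∑ uv : Bool × Bool, #{y ∈ fib q (P uv) | r y} := by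
    have e : ({y : Fin 9 → Bool | G y} : Finset (Fin 9 → Bool)) =
        (univ : Finset (Bool × Bool)).biUnion (fun uv => {y ∈ fib q (P uv) | r y}) := by
      ext y
      simp only [mem_filter, mem_univ, true_and, mem_biUnion]
      rw [hGiff y]
      constructor
      · rintro ⟨h1, h2⟩
        obtain ⟨uv, huv⟩ := (hcP y).mp h1
        exact ⟨uv, huv, h2⟩
      · rintro ⟨uv, huv, h2⟩
        exact ⟨(hcP y).mpr ⟨uv, huv⟩, h2⟩
    rw [e, card_biUnion]
    intro uv _ uv' _ hne
    exact disjoint_left.mpr fun y hy hy' => hne (hP (funext fun i => by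
      rw [← (mem_fib.mp (mem_filter.mp hy).1) i, (mem_fib.mp (mem_filter.mp hy').1) i]))
  rw [hpart] at hGeven
  push_cast at hGeven
  exact (sum_congr rfl fun uv _ =>
    natCast_card_filter_quadratic (momCond_fib_at hε (hA uv)) hr).symm.trans hGeven

/-- **No four clean fibres over four points cut out by three quadratic equations** (S5 + S6 of MM59,
localised). [this work] -/
theorem no_clean_quad (hq : ∀ i, IsDegLeFun 2 (q i)) (hε : ∀ y, Odd (ε y))
    (P : Bool × Bool → (Fin 5 → Bool)) (hP : Function.Injective P)
    (hA : ∀ uv b, fs q ε (P uv) b % 8 = 3 ∨ fs q ε (P uv) b % 8 = 5)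
    (K : Finset (Fin 5)) (hK : #K ≤ 3) (c : Fin 5 → (Fin 9 → Bool) → Bool) (hc : ∀ k, IsDegLeFun 2 (c k))
    (hcP : ∀ y, (∀ k ∈ K, c k y = false) ↔ ∃ uv, y ∈ fib q (P uv)) : False := by
  have hdist : ∀ {uv uv' : Bool × Bool}, uv ≠ uv' → cen (fib q (P uv)) ≠ cen (fib q (P uv')) := by
    intro uv uv' hne h
    exact hne (hP (cen_injective_at hq hε (hA uv) (hA uv') h))
  refine four_points (p₀ := cen (fib q (P (false, false)))) (p₁ := cen (fib q (P (false, true))))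
    (p₂ := cen (fib q (P (true, false)))) (p₃ := cen (fib q (P (true, true))))
    (hdist (by decide)) (hdist (by decide)) (hdist (by decide)) (fun j => ?_) (fun j k hjk => ?_)
  · have h := glue_even_local hε P hP hA K hK c hc hcP (isDegLeFun_apply j (le_of_lt one_lt_two))
    exact (bool_sum_four (fun uv => cen (fib q (P uv)) j)).mp h
  · have h := glue_even_local hε P hP hA K hK c hc hcP
      (isDegLeFun_and (isDegLeFun_apply j le_rfl) (isDegLeFun_apply k le_rfl) : IsDegLeFun (1 + 1) _)
    exact (bool_sum_four (fun uv => cen (fib q (P uv)) j && cen (fib q (P uv)) k)).mp h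

end Fibration

end Summit.QuantumAdvantage.QuantumAdvantage.Theorems.NearExactIsExact.Negative.MM59Local
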